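import Mathlib
import HarnessLib
import Summits.NavierStokesRegularity.NavierStokesRegularity.Theorems.WakeRatchetMinimalViscousBlowupDarkBlockLife

/-!
# Route `WakeRatchet`, crux `MinimalViscousBlowup` (stmt-NavierStokesRegularity-22743), LINE g11-1 «threshold ray» (skeleton v3.10
# ebed8644104749ae), stub S5b♭₁ `stub_litMeasureAtThreshold` (H1″) — the rate `(λ⁻²)^k` of (H1″) is OPTIMAL: a LOWER bound on lit measure

The open rigidity stub `stub_litMeasureAtThreshold` asks, along the threshold blow-up trajectory, for an UPPER bound
`volume{s ∈ [0,T) : ν²/(32768λ¹⁹) < λ^k‖X_k(s)‖²} ≤ A·(λ⁻²)^k` on the time each shell spends LIT.  This file proves the matching LOWER bound,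
UNCONDITIONALLY along every enveloped blow-up (the S4 binders of the skeleton: exact `ν`-viscous motion law from a one-shell datum at shell `0`,
no shells below `0`, weight-10 regular on every `[0,T']`, blow-up at `T`, critical envelope `λⁿ‖X_n‖² ≤ C`; NO threshold hypothesis is used):
* `litMeasure_lower_of_level` — rise-time core: under the envelope, if shell `k ≥ 1` (born dark: `X_k(0) = 0`) reaches level `b₂` at a time
  `t_f < T`, then for every `0 ≤ b₁ < b₂` it has spent at least `(b₂ − b₁)·λ^{−2k}/(256 C√C)` of time STRICTLY above level `b₁` — the whole
  window `(t_f − τ, t_f]` is lit, by the landed level-growth bound `level_growth_le` («a level rises at most at speed `256 C√C λ^{2k}`»).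
* `litMeasure_lower` — with the landed closed-valve maximum principle `reignition` (every shell `k` exceeds `ν²/(16384λ¹⁹) = 2·c₁₉ν²` before
  the blow-up), EVERY shell `k ≥ 1` is lit (level `> c₁₉ν²`, `c₁₉ = 1/(32768λ¹⁹)`, the stub's level) for at least
  `ν²/(2²³λ¹⁹ C√C) · (λ⁻²)^k`:  `ENNReal.ofReal (a · ((1+ε₀)²)⁻¹^k) ≤ volume{lit_k}` with `a = ν²/(32768λ¹⁹)/(256 C√C) > 0`.
So (H1″), if true, is SHARP: the lit time of shell `k` at threshold would be `≍ λ^{−2k}` (two-sided), i.e. `O(1)` local turnover times —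
whereas the energy identity alone gives only the one-power ceiling `E₀/(νb)·λ^{−k}` (landed `litMeasure_le_energy`, H1′).  The gap between
`a·λ^{−2k}` (this file) and `A·λ^{−2k}` (the stub) is exactly the number of turnover times a shell may stay lit — the clock content of (H1″).
MODEL lattice ODEs only (Tao's NS-scaled `ν`-viscous cascade lattice, `m = 4`); nothing here concerns the Navier–Stokes equations; no stub is
closed by name and no summit is proved by this file.  `--supports stmt-NavierStokesRegularity-22743 --as helper`.
[cite: Tao2016AveragedNS, §4 (4.1)–(4.3), Lemma 4.1 (4.5), §5; BarbatoMorandinRomito2011, §3.1]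
-/

noncomputable section

set_option linter.dupNamespace false

open Set Filter Topology MeasureTheory

namespace Summit.NavierStokesRegularity.NavierStokesRegularity.Theorems.MinimalViscousBlowup.ThresholdRay

open Literature.Analysis.FluidPDE Literature.Analysis.FluidPDE.TaoCascade

/-- **Rise-time lower bound on lit measure.**  Under an envelope `λⁿ‖X_n‖² ≤ C` on `[0,T)` for a trajectory of the `ν`-viscous lattice
(`ν ≥ 0`) with no shells below `0`, a shell `k` that is dark at time `0` (`X_k(0) = 0`) and reaches level `λ^k‖X_k(t_f)‖² ≥ b₂` at some
`t_f < T` has spent at least `(b₂ − b₁)/(256 C√C λ^{2k})` of time strictly above every lower level `b₁ ≥ 0`: the window `(t_f − τ, t_f]`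
is lit, since a level rises at most at speed `256 C√C λ^{2k}` (`level_growth_le`).  MODEL lattice only.
[cite: Tao2016AveragedNS, §4 (4.1)–(4.3), Lemma 4.1 (4.5)] -/
theorem litMeasure_lower_of_level {ε₀ ν T C : ℝ} (hε : 0 < ε₀) (hν : 0 ≤ ν)
    {α : Fin 4 → Fin 4 → Fin 4 → ℤ × ℤ × ℤ → ℝ} (hcan : IsCancellingCoeff α)
    (hα1 : ∀ i₁ i₂ i₃, |α i₁ i₂ i₃ (0, 0, 1)| ≤ 1) {X : Fin 4 → ℤ → ℝ → ℝ}
    (hcd : ∀ i n, ContDiffOn ℝ 1 (X i n) (Ico 0 T))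
    (hlow : ∀ i n t, n < 0 → X i n t = 0)
    (hmot : ∀ i n t, 0 ≤ t → t < T → derivWithin (X i n) (Ici 0) t =
      quadTerm ε₀ α X i n t - ν * (1 + ε₀) ^ ((2 : ℝ) * n) * X i n t)
    (henv : ∀ (n : ℤ) (t : ℝ), 0 ≤ t → t < T → (1 + ε₀) ^ n * ‖shellVec X n t‖ ^ 2 ≤ C)
    {k : ℕ} (hk0 : shellVec X k 0 = 0) {b₁ b₂ t_f : ℝ} (hb₁ : 0 ≤ b₁) (hb : b₁ < b₂)
    (htf0 : 0 ≤ t_f) (htfT : t_f < T) (hfire : b₂ ≤ (1 + ε₀) ^ k * ‖shellVec X k t_f‖ ^ 2) :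
    ENNReal.ofReal ((b₂ - b₁) / (256 * C * Real.sqrt C) * ((1 + ε₀) ^ 2)⁻¹ ^ k) ≤
      volume {s : ℝ | 0 ≤ s ∧ s < T ∧ b₁ < (1 + ε₀) ^ k * ‖shellVec X k s‖ ^ 2} := by
  have hl0 : (0 : ℝ) < 1 + ε₀ := by linarith
  have hT : 0 < T := lt_of_le_of_lt htf0 htfT
  have hlow' : ∀ i n t, n < 0 → 0 ≤ t → X i n t = 0 := fun i n t hn _ => hlow i n t hn
  -- the envelope constant is positive (shell `k` reaches `b₂ > 0`)
  have hCk : (1 + ε₀) ^ k * ‖shellVec X k t_f‖ ^ 2 ≤ C := by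
    have := henv k t_f htf0 htfT
    rwa [zpow_natCast] at this
  have hC0 : 0 < C := by linarith
  have hR0 : 0 < 256 * C * Real.sqrt C := by
    have := Real.sqrt_pos.2 hC0; positivity
  have hP : (0 : ℝ) < (1 + ε₀) ^ (2 * k) := pow_pos hl0 _
  set R : ℝ := 256 * C * Real.sqrt C * (1 + ε₀) ^ (2 * k) with hR
  have hRpos : 0 < R := by rw [hR]; positivity
  -- the rise time `τ = (b₂ - b₁)/R`
  set τ : ℝ := (b₂ - b₁) / R with hτ
  have hτ0 : 0 < τ := by rw [hτ]; exact div_pos (by linarith) hRpos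
  have hτeq : (b₂ - b₁) / (256 * C * Real.sqrt C) * ((1 + ε₀) ^ 2)⁻¹ ^ k = τ := by
    rw [hτ, hR, inv_pow, ← pow_mul]
    field_simp
  rw [hτeq]
  -- the level-growth bound on a window `[s, t_f]`, `T' := (t_f + T)/2`
  set T' : ℝ := (t_f + T) / 2 with hT'
  have htfT' : t_f < T' := by rw [hT']; linarith
  have hT'T : T' < T := by rw [hT']; linarith
  have hder := hasDerivWithinAt_window_of_clauses (ε₀ := ε₀) (ν := ν) (α := α) hcd hmot hT'T
  have hgrow : ∀ s : ℝ, 0 ≤ s → s ≤ t_f →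
      (1 + ε₀) ^ k * ‖shellVec X k t_f‖ ^ 2 ≤ (1 + ε₀) ^ k * ‖shellVec X k s‖ ^ 2 + R * (t_f - s) := by
    intro s hs0 hst
    have henv' : ∀ (m : ℕ) (u : ℝ), u ∈ Icc s t_f → (1 + ε₀) ^ m * ‖shellVec X m u‖ ^ 2 ≤ C := by
      intro m u hu
      have := henv m u (hs0.trans hu.1) (lt_of_le_of_lt hu.2 htfT)
      rwa [zpow_natCast] at this
    have h := level_growth_le hε hC0.le hcan hα1 hder hlow' henv' hs0 hst htfT' hν k
    rw [hR]; linarith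
  -- `t_f ≥ b₂/R ≥ τ`: shell `k` starts dark
  have htfτ : τ ≤ t_f := by
    have h := hgrow 0 le_rfl htf0
    rw [hk0, norm_zero] at h
    have h' : b₂ ≤ R * t_f := by nlinarith
    rw [hτ, div_le_iff₀ hRpos]
    nlinarith
  -- the window `(t_f - τ, t_f]` is lit
  have hsub : Ioc (t_f - τ) t_f ⊆ {s : ℝ | 0 ≤ s ∧ s < T ∧ b₁ < (1 + ε₀) ^ k * ‖shellVec X k s‖ ^ 2} := by
    intro s hs
    have hs0 : 0 ≤ s := by linarith [hs.1]
    refine ⟨hs0, lt_of_le_of_lt hs.2 htfT, ?_⟩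
    by_contra hle
    push Not at hle
    have h := hgrow s hs0 hs.2
    have h2 : R * (t_f - s) < R * τ := mul_lt_mul_of_pos_left (by linarith [hs.1]) hRpos
    have h3 : R * τ = b₂ - b₁ := by rw [hτ]; field_simp
    linarith
  calc ENNReal.ofReal τ = volume (Ioc (t_f - τ) t_f) := by rw [Real.volume_Ioc]; ring_nf
    _ ≤ volume {s : ℝ | 0 ≤ s ∧ s < T ∧ b₁ < (1 + ε₀) ^ k * ‖shellVec X k s‖ ^ 2} := measure_mono hsub

/-- **The rate of (H1″) is optimal: every shell `k ≥ 1` is lit for at least `a·λ^{−2k}`.**  Along an enveloped blow-up of the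
`ν`-viscous lattice at time `T` (the S4 binders of the skeleton «threshold ray»: one-shell datum at shell `0`, no shells below `0`, exact
motion law, weight-10 regular on every `[0,T']`, blow-up at `T`, critical envelope `λⁿ‖X_n‖² ≤ C`), for every shell `k ≥ 1`
`volume{s ∈ [0,T) : ν²/(32768λ¹⁹) < λ^k‖X_k(s)‖²} ≥ a·((1+ε₀)²)⁻¹^k` with the explicit `a = ν²/(32768λ¹⁹)/(256 C√C)` — the closed-valve
maximum principle `reignition` makes shell `k` exceed `2·ν²/(32768λ¹⁹)` before `T`, and `litMeasure_lower_of_level` converts the rise into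
lit time.  The open stub `stub_litMeasureAtThreshold` is the matching UPPER bound `≤ A·((1+ε₀)²)⁻¹^k`.  MODEL lattice only.
[cite: Tao2016AveragedNS, §4 (4.3), Lemma 4.1 (4.5), §5; BarbatoMorandinRomito2011, §3.1] -/
theorem litMeasure_lower {ε₀ ν T C : ℝ} (hε : 0 < ε₀) (hν : 0 < ν) (hT : 0 < T)
    {α : Fin 4 → Fin 4 → Fin 4 → ℤ × ℤ × ℤ → ℝ} (hcan : IsCancellingCoeff α)
    (hα1 : ∀ i₁ i₂ i₃, |α i₁ i₂ i₃ (0, 0, 1)| ≤ 1) {X₀ : Fin 4 → ℝ} {X : Fin 4 → ℤ → ℝ → ℝ}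
    (hcd : ∀ i n, ContDiffOn ℝ 1 (X i n) (Ico 0 T))
    (hinit : ∀ i n, X i n 0 = if n = 0 then X₀ i else 0)
    (hlow : ∀ i n t, n < 0 → X i n t = 0)
    (hmot : ∀ i n t, 0 ≤ t → t < T → derivWithin (X i n) (Ici 0) t =
      quadTerm ε₀ α X i n t - ν * (1 + ε₀) ^ ((2 : ℝ) * n) * X i n t)
    (hreg : ∀ T' : ℝ, 0 < T' → T' < T → ∃ M : ℝ, ∀ t : ℝ, 0 ≤ t → t ≤ T' →
      ∀ (i : Fin 4) (n : ℤ), (1 + (1 + ε₀) ^ ((10 : ℝ) * n)) * |X i n t| ≤ M)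
    (hblow : ∀ M : ℝ, ∃ t : ℝ, 0 ≤ t ∧ t < T ∧
      ∃ (i : Fin 4) (n : ℤ), M < (1 + (1 + ε₀) ^ ((10 : ℝ) * n)) * |X i n t|)
    (henv : ∀ (n : ℤ) (t : ℝ), 0 ≤ t → t < T → (1 + ε₀) ^ n * ‖shellVec X n t‖ ^ 2 ≤ C)
    {k : ℕ} (hk : 1 ≤ k) :
    ENNReal.ofReal (1 / (32768 * (1 + ε₀) ^ 19) * ν ^ 2 / (256 * C * Real.sqrt C) * ((1 + ε₀) ^ 2)⁻¹ ^ k) ≤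
      volume {s : ℝ | 0 ≤ s ∧ s < T ∧
        1 / (32768 * (1 + ε₀) ^ 19) * ν ^ 2 < (1 + ε₀) ^ k * ‖shellVec X k s‖ ^ 2} := by
  have hl0 : (0 : ℝ) < 1 + ε₀ := by linarith
  -- every shell `n ≥ 1` is dark at time `0`
  have hzero : ∀ n : ℕ, 1 ≤ n → shellVec X n 0 = 0 := by
    intro n hn
    have hsq : ‖shellVec X (n : ℤ) 0‖ ^ 2 = 0 := by
      rw [norm_shellVec_sq]
      refine Finset.sum_eq_zero fun i _ => ?_
      have hne : (n : ℤ) ≠ 0 := by exact_mod_cast (by omega : n ≠ 0)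
      rw [hinit i n, if_neg hne]; ring
    exact norm_eq_zero.1 (pow_eq_zero_iff two_ne_zero |>.1 hsq)
  -- the reignition level `c = 1/(16384 λ¹⁹) = 2 c₁₉`
  obtain ⟨c, hc⟩ : ∃ c : ℝ, c = 1 / (16384 * (1 + ε₀) ^ 19) := ⟨_, rfl⟩
  have hc0 : 0 < c := by rw [hc]; positivity
  have hc2 : 1 / (32768 * (1 + ε₀) ^ 19) * ν ^ 2 = c / 2 * ν ^ 2 := by rw [hc]; field_simp; ring
  have hdark : ∀ m : ℕ, k < m → (1 + ε₀) ^ m * ‖shellVec X m 0‖ ^ 2 ≤ c / 2 * ν ^ 2 := by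
    intro m hm
    rw [hzero m (by omega), norm_zero]
    have : 0 ≤ c / 2 * ν ^ 2 := by positivity
    simpa using this
  obtain ⟨t_f, htf0, htfT, hfire⟩ :=
    reignition hε hν hT hcan hα1 hcd hlow hmot hreg hblow henv hc0 hc.le le_rfl hT hdark
  -- rise from level `c₁₉ν² = cν²/2` to level `cν²`
  have hb₁ : 0 ≤ c / 2 * ν ^ 2 := by positivity
  have hb : c / 2 * ν ^ 2 < c * ν ^ 2 := by
    have : 0 < c * ν ^ 2 := by positivity
    linarith
  have h := litMeasure_lower_of_level hε hν.le hcan hα1 hcd hlow hmot henv (hzero k hk) hb₁ hb htf0 htfT hfire.le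
  have heq : c * ν ^ 2 - c / 2 * ν ^ 2 = c / 2 * ν ^ 2 := by ring
  rw [heq, ← hc2] at h
  exact h

end Summit.NavierStokesRegularity.NavierStokesRegularity.Theorems.MinimalViscousBlowup.ThresholdRay

end
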